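import Summits.Ventures.PercRepro.RankLevelSetLevelSevenRowSeventyTwo
import Summits.Ventures.PercRepro.RankLevelSetCoreSevenOfFormGX
import Summits.Ventures.PercRepro.RankLevelSetLevelSevenRowSeventyOneGXForm
import Summits.Ventures.PercRepro.RankLevelSetLevelSevenRowSeventyOneLarge

/-!
# PercRepro — THE ROW `71` OF LEVEL `7`: C-025 AT `q = 7` FOR EVERY FINITE MATROID AND EVERY `p ≥ 71` (p8, gen 18; a feeder
for S4 — the top of the `q = 7` window, from `72`; the first row on the GIANT-EXACT count)

Level `7` at rank `71` by the per-rank wrapper `rls_succ_large_at 6 7 71` (p8 g0, S3SixWindow): level `6` at `70`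
(`c025_six_all`) and the `e`-free core at `(71, d)` for every `d ≥ 8` — the cells `8 ≤ d ≤ 90` by their numeric forms ON THE
GIANT-EXACT COUNT (`quart_form71gx`, RankLevelSetLevelSevenRowSeventyOneGXForm: the `N`-side `C(n, 7) + σ_m·Π_E + 2^{min 79 (7+d)}`
of S2GiantExactCount — the cells `(71, 71)` and `(71, 72)` FAIL on the old count, `r + tail = 1.012 / 1.069`, and close here at
`6·10^{−6} + 0.533` / `0.566`) through `c025_core_seven_of_form_gx` (RankLevelSetCoreSevenOfFormGX), the coranks `d ≥ 91` by
the large-corank inequality at `(71, n ≥ 162)` (`largeSeven_all71`) through `c025_core_seven_large_of_ineq`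
(RankLevelSetCoreSevenOfForm). The rows `≥ 72` are `c025_seven_large_seventy_two`.
* **`c025_core_seven_at_seventy_one`** — the `e`-free core at rank `71`, every corank `d ≥ 8`;
* **`c025_seven_at_seventy_one`** — level `7` at rank `71`, every finite matroid;
* **`c025_seven_large_seventy_one`** — level `7` for every `p ≥ 71`; **`c025_seven_seventy_one`** the same in the `C025` body.
Axioms: standard.
-/

open scoped Matroid

namespace PercRepro

namespace ThmN

variable {α : Type}

/-- **The `e`-free core of level `7` at rank `71`, every corank `d ≥ 8`**: the numeric forms of the cells `(71, 8 … 90)` on the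
giant-exact count and the large-corank inequality at `(71, n ≥ 162)`. -/
theorem c025_core_seven_at_seventy_one (M : Matroid α) [M.Finite] (d : ℕ) (hd8 : 8 ≤ d) (hR : M.eRank = (71 : ℕ∞))
    (hn : M.E.ncard = 71 + d) (hfree : EFree M) : RLS M 71 7 := by
  rcases Nat.lt_or_ge d 91 with h | h
  · exact c025_core_seven_of_form_gx M 71 d hd8 hR hn hfree (quart_form71gx d hd8 (by omega))
  · exact c025_core_seven_large_of_ineq M 71 hR (largeSeven_all71 M.E.ncard (by omega)) hfree

/-- **Level `7` at rank `71`, every finite matroid**: `rls_succ_large_at 6 7 71` on level `6` at `70` (`c025_six_all`), the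
coranks `≤ 7` (`U = ∅` or Theorem M) and the core at `71`. -/
theorem c025_seven_at_seventy_one (M : Matroid α) [M.Finite] : RLS M 71 7 := by
  refine rls_succ_large_at (α := α) 6 7 71 (by norm_num) (fun M _ => c025_six_all M 70 (by norm_num)) ?_ ?_ M
  · -- corank `≤ 7`: `U = ∅` or Theorem M
    intro M _ hn
    rcases Nat.lt_or_ge M.E.ncard (71 + 7) with h | h
    · exact RLS_of_ncard_lt M h
    · exact RLS_of_ncard_eq M (by omega)
  · -- the core at corank `≥ 8`
    intro M _ hR hbig hfree
    exact c025_core_seven_at_seventy_one M (M.E.ncard - 71) (by omega) hR (by omega) hfree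

/-- **THEOREM C₇ AT `71`, UNCONDITIONAL OVER THE TREE**: every finite matroid satisfies C-025 at level `7` for every
`p ≥ 71` — the row `71` by `c025_seven_at_seventy_one`, the rows `≥ 72` by `c025_seven_large_seventy_two`. -/
theorem c025_seven_large_seventy_one (M : Matroid α) [M.Finite] (p : ℕ) (hp : 71 ≤ p) : RLS M p 7 := by
  rcases Nat.lt_or_ge p 72 with h | h
  · have h71 : p = 71 := by omega
    subst h71
    exact c025_seven_at_seventy_one M
  · exact c025_seven_large_seventy_two M p h

/-- The same in the literal `C025` body: `phiK p 7 · #U(p, 7) ≤ #Y(p, 7)` for every finite matroid and every `p ≥ 71`. -/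
theorem c025_seven_seventy_one (M : Matroid α) [M.Finite] (p : ℕ) (hp : 71 ≤ p) :
    phiK p 7 * ({A : Set α | A ⊆ M.E ∧ M.eRk A = (p : ℕ∞) ∧ M.eRk (M.E \ A) = (7 : ℕ∞)}.ncard : ℚ) ≤
      ({A : Set α | A ⊆ M.E ∧ (7 : ℕ∞) < M.eRk A ∧ M.eRk A < (p : ℕ∞)}.ncard : ℚ) :=
  c025_seven_large_seventy_one M p hp

end ThmN

end PercRepro
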